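import Literature.NumberTheory.Transcendental.ZeroEstDerivatives
import Mathlib.Analysis.Calculus.FDeriv.Symmetric
import Mathlib.LinearAlgebra.Quotient.Basic
import Mathlib.Algebra.Polynomial.Roots
import HarnessLib

/-!
# Zero estimates on commutative algebraic groups, V: commuting derivations on `ℂ[X] ⧸ 𝔊`, polarisation

Topic `Literature/NumberTheory/Transcendental`. Fifth module of the discharge of
`Literature.NumberTheory.Transcendental.philippon1986_std` through D. Roy's exposition of
Philippon's zero estimate (Nesterenko–Philippon (eds.), LNM 1752, Ch. 11, §3) for an abstract
analytic group model `M : AnalyticGroupModel V N`. The chart derivations `𝒟_{J₀,x}` of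
`ZeroEstDerivatives.lean` preserve `𝔊`, so they induce derivations `d_{J₀,x}` of the graded domain
`A = ℂ[X₀,…,X_N] ⧸ 𝔊` (the homogeneous coordinate ring of `Ḡ`). On `A`:

* `M.evalQ a : A →ₐ[ℂ] ℂ` — evaluation at the point `Θ(a)` of the cone (`evalQ_mk : evalQ a [P] = F_P(a)`).
* `M.quotDer J₀ x : Derivation ℂ A A` (`quotDer_mk : d [P] = [𝒟 P]`), and — this is why we pass
  to `A` — **the `d_{J₀,x}` pairwise commute and depend linearly on `x`** (`quotDer_comm`,
  `quotDer_add`, `quotDer_smul`): on the chart `{Θ_{J₀} ≠ 0}` one has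
  `F_{𝒟_x𝒟_yP} = Θ_{J₀}^{D+2}·∂_x∂_y(F_P/Θ_{J₀}^D)` (`F_chartDer_chartDer`), symmetric in `x, y` by
  the symmetry of second derivatives of analytic functions (`ContDiffAt.isSymmSndFDerivAt`), and
  `F_{𝒟_{x+y}P} = F_{𝒟_xP} + F_{𝒟_yP}`; two forms whose `F`'s agree on a non-empty open set agree
  everywhere (identity theorem), i.e. are equal in `A`. (Roy's Lemma 3.3
  `∂^λ∂^κ = ∂^{λ+κ}`, in the chart.) This needs `Θ_{J₀} ≢ 0`, i.e. a point `a` with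
  `Θ_{J₀}(a) ≠ 0`, which is how the chart is always chosen.
* `M.opPowQ J₀ w μ = d_{w₁}^{μ₁} ∘ ⋯ ∘ d_{w_s}^{μ_s}` (the `D^μ` of `PhilipponZeroEstimateMultiplicity.lean`)
  and **polarisation** (`evalQ_opPowQ_eq_zero_of_pure`): if `evalQ a (d_x^k q) = 0` for all
  `x ∈ W`, `k ≤ T`, then `evalQ a (D^μ q) = 0` for all `w_i ∈ W`, `|μ| ≤ T` — by induction on `s`,
  expanding `(t·d_{w₁} + d_v)^n` by the binomial formula for commuting operators
  (`Commute.add_pow`) and extracting coefficients of the polynomial in `t`.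
* The order of vanishing of a form at a chart point, read in `A`
  (`vanishesToOrder_iff_quotDer`): `VanishesToOrder W F_P a T ↔ ∀ x ∈ W, k < T,
  evalQ a (d_x^k [P]) = 0`.

Everything is PROVED.

## References

* Yu. V. Nesterenko, P. Philippon (eds.), *Introduction to Algebraic Independence Theory*,
  LNM 1752, Springer 2001, Ch. 11 (D. Roy), §3.1, Lemma 3.3, Prop. 3.8 Step 3. [NesterenkoPhilippon2001]
* P. Philippon, *Lemmes de zéros dans les groupes algébriques commutatifs*, Bull. Soc. Math.
  France 114 (1986), 355–383, §4, Lemme 4.6. [Philippon1986]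
-/

noncomputable section

open MvPolynomial Set Filter Topology
open scoped Pointwise ContDiff

namespace Literature.NumberTheory.Transcendental

namespace AnalyticGroupModel

variable {V : Type*} [NormedAddCommGroup V] [NormedSpace ℂ V] {N : ℕ} (M : AnalyticGroupModel V N)

attribute [local instance] MvPolynomial.gradedAlgebra

/-! ### The quotient algebra `A = ℂ[X] ⧸ 𝔊` and evaluation at points -/

/-- The homogeneous coordinate ring `A = ℂ[X₀, …, X_N] ⧸ 𝔊` of `Ḡ`. [cite: NesterenkoPhilippon2001, Ch. 11 §2.2] -/
abbrev Quot : Type _ := MvPolynomial (Fin (N + 1)) ℂ ⧸ M.relIdeal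

/-- **Evaluation at the point `Θ(a)` of the cone**, an algebra map `A →ₐ[ℂ] ℂ` (`𝔊` vanishes at
`Θ(a)`). [folklore] -/
def evalQ (a : V) : M.Quot →ₐ[ℂ] ℂ :=
  Ideal.Quotient.liftₐ M.relIdeal (aeval (M.pt a)) fun P hP => by
    have := hP a (mem_univ a) 1
    rw [one_smul] at this
    rw [← coe_aeval_eq_eval] at this
    exact this

/-- `evalQ a [P] = F_P(a)`. [folklore] -/
@[simp] theorem evalQ_mk (a : V) (P : MvPolynomial (Fin (N + 1)) ℂ) :
    M.evalQ a (Ideal.Quotient.mk M.relIdeal P) = M.F P a := by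
  change Ideal.Quotient.lift M.relIdeal ((aeval (M.pt a) : MvPolynomial (Fin (N + 1)) ℂ →ₐ[ℂ] ℂ) :
    MvPolynomial (Fin (N + 1)) ℂ →+* ℂ) _ (Ideal.Quotient.mk M.relIdeal P) = _
  rw [Ideal.Quotient.lift_mk, RingHom.coe_coe, F, ← coe_aeval_eq_eval]
  rfl

/-- Two polynomials with the same `F` on all of `V`... no: two FORMS of the same degree with equal
`F` have equal classes in `A`. [folklore] -/
theorem mk_eq_mk_of_F_eq {P Q : MvPolynomial (Fin (N + 1)) ℂ} {D : ℕ} (hP : P.IsHomogeneous D)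
    (hQ : Q.IsHomogeneous D) (h : M.F P = M.F Q) :
    Ideal.Quotient.mk M.relIdeal P = Ideal.Quotient.mk M.relIdeal Q := by
  rw [Ideal.Quotient.eq, M.mem_relIdeal_iff_of_isHomogeneous (hP.sub hQ)]
  intro w
  rw [show M.F (P - Q) w = M.F P w - M.F Q w by simp [F], h, sub_self]

/-- **Forms whose `F`'s agree on a neighbourhood agree in `A`** (identity theorem). [folklore] -/
theorem mk_eq_mk_of_F_eventuallyEq {P Q : MvPolynomial (Fin (N + 1)) ℂ} {D : ℕ} (hP : P.IsHomogeneous D)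
    (hQ : Q.IsHomogeneous D) {a : V} (h : M.F P =ᶠ[𝓝 a] M.F Q) :
    Ideal.Quotient.mk M.relIdeal P = Ideal.Quotient.mk M.relIdeal Q := by
  refine M.mk_eq_mk_of_F_eq hP hQ ?_
  exact (M.analyticOnNhd_F P).eq_of_eventuallyEq (M.analyticOnNhd_F Q) h

/-! ### The induced derivations of `A` -/

/-- The `ℂ`-linear map `[P] ↦ [𝒟 P]` on `A`. [folklore] -/
def quotDerLin (J₀ : Fin (N + 1)) (x : V) : M.Quot →ₗ[ℂ] M.Quot :=
  ((M.relIdeal.restrictScalars ℂ).liftQ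
      ((Ideal.Quotient.mkₐ ℂ M.relIdeal).toLinearMap ∘ₗ (M.chartDer J₀ x).toLinearMap)
      (fun P hP => by
        rw [LinearMap.mem_ker, LinearMap.comp_apply]
        change Ideal.Quotient.mk M.relIdeal (M.chartDer J₀ x P) = 0
        exact Ideal.Quotient.eq_zero_iff_mem.mpr (M.chartDer_mem_relIdeal J₀ x hP))) ∘ₗ
    (Submodule.Quotient.restrictScalarsEquiv ℂ M.relIdeal).symm.toLinearMap

/-- `quotDerLin [P] = [𝒟 P]`. [folklore] -/
theorem quotDerLin_mk (J₀ : Fin (N + 1)) (x : V) (P : MvPolynomial (Fin (N + 1)) ℂ) :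
    M.quotDerLin J₀ x (Ideal.Quotient.mk M.relIdeal P) = Ideal.Quotient.mk M.relIdeal (M.chartDer J₀ x P) := by
  rw [quotDerLin, LinearMap.comp_apply]
  have : (Submodule.Quotient.restrictScalarsEquiv ℂ M.relIdeal).symm.toLinearMap
      (Ideal.Quotient.mk M.relIdeal P) = Submodule.Quotient.mk P := by
    rw [LinearEquiv.coe_toLinearMap, LinearEquiv.symm_apply_eq,
      Submodule.Quotient.restrictScalarsEquiv_mk]
    rfl
  rw [this, Submodule.liftQ_apply]
  rfl

/-- **The derivation `d_{J₀,x}` of `A = ℂ[X] ⧸ 𝔊` induced by the chart derivation `𝒟_{J₀,x}`.**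
[cite: NesterenkoPhilippon2001, Ch. 11 §3.1] -/
def quotDer (J₀ : Fin (N + 1)) (x : V) : Derivation ℂ M.Quot M.Quot where
  toLinearMap := M.quotDerLin J₀ x
  map_one_eq_zero' := by
    change M.quotDerLin J₀ x (Ideal.Quotient.mk M.relIdeal 1) = 0
    rw [quotDerLin_mk, Derivation.map_one_eq_zero, map_zero]
  leibniz' := by
    intro a b
    obtain ⟨P, rfl⟩ := Ideal.Quotient.mk_surjective a
    obtain ⟨Q, rfl⟩ := Ideal.Quotient.mk_surjective b
    change M.quotDerLin J₀ x (Ideal.Quotient.mk M.relIdeal (P * Q)) = _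
    rw [quotDerLin_mk, Derivation.leibniz]
    change _ = Ideal.Quotient.mk M.relIdeal P • M.quotDerLin J₀ x (Ideal.Quotient.mk M.relIdeal Q) +
      Ideal.Quotient.mk M.relIdeal Q • M.quotDerLin J₀ x (Ideal.Quotient.mk M.relIdeal P)
    rw [quotDerLin_mk, quotDerLin_mk, smul_eq_mul, smul_eq_mul, smul_eq_mul, smul_eq_mul,
      map_add, map_mul, map_mul]

/-- `d [P] = [𝒟 P]`. [folklore] -/
@[simp] theorem quotDer_mk (J₀ : Fin (N + 1)) (x : V) (P : MvPolynomial (Fin (N + 1)) ℂ) :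
    M.quotDer J₀ x (Ideal.Quotient.mk M.relIdeal P) = Ideal.Quotient.mk M.relIdeal (M.chartDer J₀ x P) :=
  M.quotDerLin_mk J₀ x P

/-- `d^k [P] = [𝒟^k P]`. [folklore] -/
theorem quotDer_iterate_mk (J₀ : Fin (N + 1)) (x : V) (k : ℕ) (P : MvPolynomial (Fin (N + 1)) ℂ) :
    (M.quotDer J₀ x)^[k] (Ideal.Quotient.mk M.relIdeal P) =
      Ideal.Quotient.mk M.relIdeal ((M.chartDer J₀ x)^[k] P) := by
  induction k with
  | zero => rfl
  | succ k ih => rw [Function.iterate_succ_apply', Function.iterate_succ_apply', ih, quotDer_mk]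

/-! ### The chart function `φ = F_P/Θ_{J₀}^D` and second derivatives -/

section Chart

variable {J₀ : Fin (N + 1)}

/-- The chart function of a form: `φ_P(w) = F_P(w)/Θ_{J₀}(w)^D`. [folklore] -/
def chartFun (J₀ : Fin (N + 1)) (D : ℕ) (P : MvPolynomial (Fin (N + 1)) ℂ) (w : V) : ℂ :=
  M.F P w / M.Θ J₀ w ^ D

/-- The chart is open. [folklore] -/
theorem isOpen_chart (J₀ : Fin (N + 1)) : IsOpen {w : V | M.Θ J₀ w ≠ 0} :=
  isOpen_ne.preimage (M.analyticOnNhd_Θ J₀).continuous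

/-- `φ_P` is analytic on the chart. [folklore] -/
theorem analyticAt_chartFun (D : ℕ) (P : MvPolynomial (Fin (N + 1)) ℂ) {w : V} (hw : M.Θ J₀ w ≠ 0) :
    AnalyticAt ℂ (M.chartFun J₀ D P) w :=
  ((M.analyticOnNhd_F P) w trivial).div (((M.analyticOnNhd_Θ J₀) w trivial).pow D) (pow_ne_zero D hw)

/-- `F_{𝒟_y P} = Θ_{J₀}^{D+1} · ∂_yφ_P` on the chart, with `∂_y` the line derivative. [folklore] -/
theorem F_chartDer_eq_pow_mul_lineDeriv (y : V) {P : MvPolynomial (Fin (N + 1)) ℂ} {D : ℕ}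
    (hP : P.IsHomogeneous D) {w : V} (hw : M.Θ J₀ w ≠ 0) :
    M.F (M.chartDer J₀ y P) w = M.Θ J₀ w ^ (D + 1) * lineDeriv ℂ (M.chartFun J₀ D P) w y :=
  M.F_chartDer_eq_pow_mul_deriv J₀ y hP hw

/-- On the chart, `∂_yφ_P = F_{𝒟_yP}/Θ_{J₀}^{D+1} = φ_{𝒟_yP}` (as functions near a chart point).
[folklore] -/
theorem chartFun_chartDer_eventuallyEq (y : V) {P : MvPolynomial (Fin (N + 1)) ℂ} {D : ℕ}
    (hP : P.IsHomogeneous D) {w : V} (hw : M.Θ J₀ w ≠ 0) :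
    (fun w' => lineDeriv ℂ (M.chartFun J₀ D P) w' y) =ᶠ[𝓝 w] M.chartFun J₀ (D + 1) (M.chartDer J₀ y P) := by
  filter_upwards [(M.isOpen_chart J₀).mem_nhds hw] with w' hw'
  rw [chartFun, M.F_chartDer_eq_pow_mul_lineDeriv y hP hw', mul_div_cancel_left₀ _ (pow_ne_zero _ hw')]

omit M in
/-- `lineDeriv` depends only on the germ of the function. [folklore] -/
theorem lineDeriv_congr_of_eventuallyEq {f g : V → ℂ} {w : V} (h : f =ᶠ[𝓝 w] g) (v : V) :
    lineDeriv ℂ f w v = lineDeriv ℂ g w v := by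
  unfold lineDeriv
  apply Filter.EventuallyEq.deriv_eq
  have hc : ContinuousAt (fun t : ℂ => w + t • v) 0 :=
    (continuous_const.add (continuous_id.smul continuous_const)).continuousAt
  have h' : f =ᶠ[𝓝 (w + (0 : ℂ) • v)] g := by simpa using h
  exact hc.eventually h' |>.mono fun t ht => ht

/-- **`F_{𝒟_x𝒟_yP}(w) = Θ_{J₀}(w)^{D+2} · ∂_x∂_yφ_P(w)`** on the chart.
[cite: NesterenkoPhilippon2001, Ch. 11 Lemma 3.3] -/
theorem F_chartDer_chartDer (x y : V) {P : MvPolynomial (Fin (N + 1)) ℂ} {D : ℕ}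
    (hP : P.IsHomogeneous D) {w : V} (hw : M.Θ J₀ w ≠ 0) :
    M.F (M.chartDer J₀ x (M.chartDer J₀ y P)) w =
      M.Θ J₀ w ^ (D + 2) * lineDeriv ℂ (fun w' => lineDeriv ℂ (M.chartFun J₀ D P) w' y) w x := by
  rw [M.F_chartDer_eq_pow_mul_lineDeriv x (M.isHomogeneous_chartDer J₀ y hP) hw,
    show D + 1 + 1 = D + 2 by ring]
  congr 1
  exact (lineDeriv_congr_of_eventuallyEq (M.chartFun_chartDer_eventuallyEq y hP hw) x).symm

omit M in
/-- **Symmetry of second line derivatives of an analytic function.** [folklore] -/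
theorem lineDeriv_lineDeriv_comm {f : V → ℂ} {w : V} (hf : AnalyticAt ℂ f w) (x y : V) :
    lineDeriv ℂ (fun w' => lineDeriv ℂ f w' y) w x = lineDeriv ℂ (fun w' => lineDeriv ℂ f w' x) w y := by
  -- near `w`, `f` is analytic, so `lineDeriv f · v = fderiv f · v`
  obtain ⟨U, hU, hUf⟩ : ∃ U ∈ 𝓝 w, ∀ w' ∈ U, AnalyticAt ℂ f w' := by
    obtain ⟨U, hUn, hUa⟩ := hf.exists_mem_nhds_analyticOnNhd
    exact ⟨U, hUn, fun w' hw' => hUa w' hw'⟩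
  have hev : ∀ v, (fun w' => lineDeriv ℂ f w' v) =ᶠ[𝓝 w] fun w' => fderiv ℂ f w' v := fun v =>
    Filter.eventually_of_mem hU fun w' hw' => (hUf w' hw').differentiableAt.lineDeriv_eq_fderiv
  rw [lineDeriv_congr_of_eventuallyEq (hev y), lineDeriv_congr_of_eventuallyEq (hev x)]
  -- `w' ↦ fderiv f w' v` is differentiable at `w`, with derivative `u ↦ fderiv (fderiv f) w u v`
  have hdiff : DifferentiableAt ℂ (fderiv ℂ f) w := (hf.fderiv).differentiableAt
  have key : ∀ v u, lineDeriv ℂ (fun w' => fderiv ℂ f w' v) w u = fderiv ℂ (fderiv ℂ f) w u v := by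
    intro v u
    have h1 : HasFDerivAt (fun w' => fderiv ℂ f w' v)
        ((ContinuousLinearMap.apply ℂ ℂ v).comp (fderiv ℂ (fderiv ℂ f) w)) w :=
      (ContinuousLinearMap.apply ℂ ℂ v).hasFDerivAt.comp w hdiff.hasFDerivAt
    rw [h1.differentiableAt.lineDeriv_eq_fderiv, h1.fderiv]
    rfl
  rw [key, key]
  exact (hf.contDiffAt (n := ω)).isSymmSndFDerivAt (by simp) x y

/-- **The chart derivations commute on `F`'s**: `F_{𝒟_x𝒟_yP} = F_{𝒟_y𝒟_xP}` on the chart. [folklore] -/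
theorem F_chartDer_comm_of_ne_zero (x y : V) {P : MvPolynomial (Fin (N + 1)) ℂ} {D : ℕ}
    (hP : P.IsHomogeneous D) {w : V} (hw : M.Θ J₀ w ≠ 0) :
    M.F (M.chartDer J₀ x (M.chartDer J₀ y P)) w = M.F (M.chartDer J₀ y (M.chartDer J₀ x P)) w := by
  rw [M.F_chartDer_chartDer x y hP hw, M.F_chartDer_chartDer y x hP hw,
    lineDeriv_lineDeriv_comm (M.analyticAt_chartFun D P hw) x y]

/-- **The chart derivations are additive in the direction on `F`'s**, on the chart. [folklore] -/
theorem F_chartDer_add_of_ne_zero (x y : V) {P : MvPolynomial (Fin (N + 1)) ℂ} {D : ℕ}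
    (hP : P.IsHomogeneous D) {w : V} (hw : M.Θ J₀ w ≠ 0) :
    M.F (M.chartDer J₀ (x + y) P) w = M.F (M.chartDer J₀ x P) w + M.F (M.chartDer J₀ y P) w := by
  have hd : DifferentiableAt ℂ (M.chartFun J₀ D P) w := (M.analyticAt_chartFun D P hw).differentiableAt
  rw [M.F_chartDer_eq_pow_mul_lineDeriv (x + y) hP hw, M.F_chartDer_eq_pow_mul_lineDeriv x hP hw,
    M.F_chartDer_eq_pow_mul_lineDeriv y hP hw, hd.lineDeriv_eq_fderiv, hd.lineDeriv_eq_fderiv,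
    hd.lineDeriv_eq_fderiv, map_add, mul_add]

/-- The chart derivations are homogeneous in the direction on `F`'s, on the chart. [folklore] -/
theorem F_chartDer_smul_of_ne_zero (c : ℂ) (x : V) {P : MvPolynomial (Fin (N + 1)) ℂ} {D : ℕ}
    (hP : P.IsHomogeneous D) {w : V} (hw : M.Θ J₀ w ≠ 0) :
    M.F (M.chartDer J₀ (c • x) P) w = c * M.F (M.chartDer J₀ x P) w := by
  have hd : DifferentiableAt ℂ (M.chartFun J₀ D P) w := (M.analyticAt_chartFun D P hw).differentiableAt
  rw [M.F_chartDer_eq_pow_mul_lineDeriv (c • x) hP hw, M.F_chartDer_eq_pow_mul_lineDeriv x hP hw,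
    hd.lineDeriv_eq_fderiv, hd.lineDeriv_eq_fderiv, map_smul, smul_eq_mul]
  ring

end Chart

/-! ### Commutation and linearity in `A` -/

section Quotient

variable {J₀ : Fin (N + 1)} {a₀ : V} (ha₀ : M.Θ J₀ a₀ ≠ 0)
include ha₀

/-- Two forms of the same degree whose `F`'s agree on the chart are equal in `A`. [folklore] -/
theorem mk_eq_mk_of_F_eq_on_chart {P Q : MvPolynomial (Fin (N + 1)) ℂ} {D : ℕ} (hP : P.IsHomogeneous D)
    (hQ : Q.IsHomogeneous D) (h : ∀ w, M.Θ J₀ w ≠ 0 → M.F P w = M.F Q w) :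
    Ideal.Quotient.mk M.relIdeal P = Ideal.Quotient.mk M.relIdeal Q :=
  M.mk_eq_mk_of_F_eventuallyEq hP hQ (a := a₀)
    (Filter.eventually_of_mem ((M.isOpen_chart J₀).mem_nhds ha₀) fun w hw => h w hw)

/-- **The derivations `d_{J₀,x}`, `d_{J₀,y}` of `A` commute** (for a chart index with
`Θ_{J₀} ≢ 0`). [cite: NesterenkoPhilippon2001, Ch. 11 Lemma 3.3] -/
theorem quotDer_comm (x y : V) (q : M.Quot) :
    M.quotDer J₀ x (M.quotDer J₀ y q) = M.quotDer J₀ y (M.quotDer J₀ x q) := by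
  obtain ⟨P, rfl⟩ := Ideal.Quotient.mk_surjective q
  -- reduce to homogeneous components
  rw [← sum_homogeneousComponent P]
  simp only [map_sum]
  refine Finset.sum_congr rfl fun d _ => ?_
  have hPd := homogeneousComponent_isHomogeneous d P
  rw [quotDer_mk, quotDer_mk, quotDer_mk, quotDer_mk]
  exact M.mk_eq_mk_of_F_eq_on_chart ha₀
    (M.isHomogeneous_chartDer J₀ x (M.isHomogeneous_chartDer J₀ y hPd))
    (M.isHomogeneous_chartDer J₀ y (M.isHomogeneous_chartDer J₀ x hPd))
    fun w hw => M.F_chartDer_comm_of_ne_zero x y hPd hw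

/-- **`d_{J₀,x+y} = d_{J₀,x} + d_{J₀,y}`.** [folklore] -/
theorem quotDer_add (x y : V) (q : M.Quot) :
    M.quotDer J₀ (x + y) q = M.quotDer J₀ x q + M.quotDer J₀ y q := by
  obtain ⟨P, rfl⟩ := Ideal.Quotient.mk_surjective q
  rw [← sum_homogeneousComponent P]
  simp only [map_sum, ← Finset.sum_add_distrib]
  refine Finset.sum_congr rfl fun d _ => ?_
  have hPd := homogeneousComponent_isHomogeneous d P
  rw [quotDer_mk, quotDer_mk, quotDer_mk, ← map_add]
  exact M.mk_eq_mk_of_F_eq_on_chart ha₀ (M.isHomogeneous_chartDer J₀ (x + y) hPd)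
    ((M.isHomogeneous_chartDer J₀ x hPd).add (M.isHomogeneous_chartDer J₀ y hPd))
    fun w hw => by rw [F_add, M.F_chartDer_add_of_ne_zero x y hPd hw]

/-- **`d_{J₀,c•x} = c · d_{J₀,x}`.** [folklore] -/
theorem quotDer_smul (c : ℂ) (x : V) (q : M.Quot) :
    M.quotDer J₀ (c • x) q = c • M.quotDer J₀ x q := by
  obtain ⟨P, rfl⟩ := Ideal.Quotient.mk_surjective q
  rw [← sum_homogeneousComponent P]
  simp only [map_sum, Finset.smul_sum]
  refine Finset.sum_congr rfl fun d _ => ?_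
  have hPd := homogeneousComponent_isHomogeneous d P
  rw [quotDer_mk, quotDer_mk, ← Ideal.Quotient.mkₐ_eq_mk ℂ, ← map_smul, Ideal.Quotient.mkₐ_eq_mk]
  rw [show c • M.chartDer J₀ x (homogeneousComponent d P) =
    MvPolynomial.C c * M.chartDer J₀ x (homogeneousComponent d P) by rw [MvPolynomial.smul_eq_C_mul]]
  refine M.mk_eq_mk_of_F_eq_on_chart ha₀ (M.isHomogeneous_chartDer J₀ (c • x) hPd) ?_
    fun w hw => by rw [F_mul, F_C, M.F_chartDer_smul_of_ne_zero c x hPd hw]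
  simpa using (isHomogeneous_C _ c).mul (M.isHomogeneous_chartDer J₀ x hPd)

/-- The sum formula: `d_{J₀, ∑ cᵢ wᵢ} = ∑ cᵢ d_{J₀,wᵢ}` on `A`. [folklore] -/
theorem quotDer_sum {ι : Type*} (s : Finset ι) (c : ι → ℂ) (w : ι → V) (q : M.Quot) :
    M.quotDer J₀ (∑ i ∈ s, c i • w i) q = ∑ i ∈ s, c i • M.quotDer J₀ (w i) q := by
  classical
  induction s using Finset.induction_on with
  | empty =>
    simp only [Finset.sum_empty]
    -- `d_0 = 0`
    have h0 : M.quotDer J₀ (0 : V) q = M.quotDer J₀ ((0 : ℂ) • (0 : V)) q := by rw [zero_smul]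
    rw [h0, M.quotDer_smul ha₀, zero_smul]
  | insert i s hi ih =>
    rw [Finset.sum_insert hi, Finset.sum_insert hi, M.quotDer_add ha₀, M.quotDer_smul ha₀, ih]

end Quotient

/-! ### Orders of vanishing read in `A` -/

/-- **The order of a form at a chart point, read on `A`**: for `Θ_{J₀}(a) ≠ 0` and a form `P`,
`F_P` vanishes to order `T` along `W` at `a` iff `evalQ a (d_{J₀,x}^k [P]) = 0` for all `x ∈ W`,
`k < T`. [cite: NesterenkoPhilippon2001, Ch. 11 Def. 3.2, Prop. 3.6 (iii)] -/
theorem vanishesToOrder_iff_quotDer {J₀ : Fin (N + 1)} {a : V} (ha : M.Θ J₀ a ≠ 0)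
    {P : MvPolynomial (Fin (N + 1)) ℂ} {D : ℕ} (hP : P.IsHomogeneous D) (W : Submodule ℂ V) (T : ℕ) :
    VanishesToOrder W (M.F P) a T ↔
      ∀ x ∈ W, ∀ k < T, M.evalQ a ((M.quotDer J₀ x)^[k] (Ideal.Quotient.mk M.relIdeal P)) = 0 := by
  rw [M.vanishesToOrder_iff_chartDer ha hP W T]
  refine forall₂_congr fun x _ => forall₂_congr fun k _ => ?_
  rw [quotDer_iterate_mk, evalQ_mk]

/-! ### The operators `D^μ` and polarisation -/

/-- **`D^μ = d_{w₀}^{μ₀} ∘ ⋯ ∘ d_{w_{s-1}}^{μ_{s-1}}`** on `A` (cf. `GaGm.opPow`). [cite: NesterenkoPhilippon2001, Ch. 11 Prop. 3.8 Step 3] -/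
def opPowQ (J₀ : Fin (N + 1)) {s : ℕ} (w : Fin s → V) (μ : Fin s → ℕ) (q : M.Quot) : M.Quot :=
  (List.ofFn fun i => (w i, μ i)).foldr (fun p q => (M.quotDer J₀ p.1)^[p.2] q) q

/-- `D^μ` for `s = 0` is the identity. [folklore] -/
@[simp] theorem opPowQ_zero (J₀ : Fin (N + 1)) (w : Fin 0 → V) (μ : Fin 0 → ℕ) (q : M.Quot) :
    M.opPowQ J₀ w μ q = q := by
  simp [opPowQ]

/-- Recursion of `D^μ`. [folklore] -/
theorem opPowQ_succ (J₀ : Fin (N + 1)) {s : ℕ} (w : Fin (s + 1) → V) (μ : Fin (s + 1) → ℕ) (q : M.Quot) :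
    M.opPowQ J₀ w μ q = (M.quotDer J₀ (w 0))^[μ 0] (M.opPowQ J₀ (Fin.tail w) (Fin.tail μ) q) := by
  simp only [opPowQ, List.ofFn_succ, List.foldr_cons]
  rfl

/-- Iterates of `d_x` are additive. [folklore] -/
theorem iterate_quotDer_add (J₀ : Fin (N + 1)) (x : V) (k : ℕ) (p q : M.Quot) :
    (M.quotDer J₀ x)^[k] (p + q) = (M.quotDer J₀ x)^[k] p + (M.quotDer J₀ x)^[k] q := by
  induction k generalizing p q with
  | zero => rfl
  | succ k ih => rw [Function.iterate_succ_apply, Function.iterate_succ_apply,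
      Function.iterate_succ_apply, map_add, ih]

/-- Iterates of `d_x` are `ℂ`-homogeneous. [folklore] -/
theorem iterate_quotDer_smul (J₀ : Fin (N + 1)) (x : V) (k : ℕ) (c : ℂ) (q : M.Quot) :
    (M.quotDer J₀ x)^[k] (c • q) = c • (M.quotDer J₀ x)^[k] q := by
  induction k generalizing q with
  | zero => rfl
  | succ k ih => rw [Function.iterate_succ_apply, Function.iterate_succ_apply, Derivation.map_smul, ih]

/-- Powers in `Module.End` are iterates. [folklore] -/
theorem pow_apply_eq_iterate (L : Derivation ℂ M.Quot M.Quot) (k : ℕ) (p : M.Quot) :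
    (((L : M.Quot →ₗ[ℂ] M.Quot) : Module.End ℂ M.Quot) ^ k) p = L^[k] p := by
  induction k generalizing p with
  | zero => rfl
  | succ k ih =>
    rw [pow_succ, Module.End.mul_apply, ih, Function.iterate_succ_apply]
    rfl

omit M in
/-- **Coefficient extraction**: if `∑_{k ≤ n} binom(n,k) t^k c_k = 0` for all `t ∈ ℂ` then all
`c_k = 0`. [folklore] -/
theorem coeff_eq_zero_of_forall_sum_eq_zero {n : ℕ} (c : ℕ → ℂ)
    (h : ∀ t : ℂ, ∑ k ∈ Finset.range (n + 1), ((n.choose k : ℂ) * t ^ k) * c k = 0) :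
    ∀ k ≤ n, c k = 0 := by
  classical
  set p : Polynomial ℂ := ∑ k ∈ Finset.range (n + 1), Polynomial.monomial k ((n.choose k : ℂ) * c k) with hp
  have hev : ∀ t : ℂ, p.eval t = ∑ k ∈ Finset.range (n + 1), ((n.choose k : ℂ) * t ^ k) * c k := by
    intro t
    rw [hp, Polynomial.eval_finsetSum]
    exact Finset.sum_congr rfl fun k _ => by rw [Polynomial.eval_monomial]; ring
  have hp0 : p = 0 := Polynomial.funext fun t => by rw [hev, h t, Polynomial.eval_zero]
  intro k hk
  have hcoeff : p.coeff k = 0 := by rw [hp0, Polynomial.coeff_zero]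
  rw [hp, Polynomial.finsetSum_coeff] at hcoeff
  simp only [Polynomial.coeff_monomial, Finset.sum_ite_eq', Finset.mem_range] at hcoeff
  rw [if_pos (by omega)] at hcoeff
  have hne : (n.choose k : ℂ) ≠ 0 := by exact_mod_cast (Nat.choose_pos hk).ne'
  exact (mul_eq_zero.mp hcoeff).resolve_left hne

section Polar

variable {J₀ : Fin (N + 1)} {a₀ : V} (ha₀ : M.Θ J₀ a₀ ≠ 0)
include ha₀

/-- Iterates of `d_x` and `d_y` commute. [folklore] -/
theorem iterate_quotDer_comm (x y : V) (k : ℕ) (q : M.Quot) :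
    (M.quotDer J₀ x)^[k] (M.quotDer J₀ y q) = M.quotDer J₀ y ((M.quotDer J₀ x)^[k] q) := by
  induction k generalizing q with
  | zero => rfl
  | succ k ih => rw [Function.iterate_succ_apply, Function.iterate_succ_apply, ← M.quotDer_comm ha₀, ih]

/-- `D^μ` commutes with every `d_x`. [folklore] -/
theorem opPowQ_quotDer {s : ℕ} (w : Fin s → V) (μ : Fin s → ℕ) (x : V) (q : M.Quot) :
    M.opPowQ J₀ w μ (M.quotDer J₀ x q) = M.quotDer J₀ x (M.opPowQ J₀ w μ q) := by
  induction s with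
  | zero => rfl
  | succ s ih => rw [opPowQ_succ, opPowQ_succ, ih, M.iterate_quotDer_comm ha₀]

/-- `D^μ` commutes with iterates of `d_x`. [folklore] -/
theorem opPowQ_iterate {s : ℕ} (w : Fin s → V) (μ : Fin s → ℕ) (x : V) (k : ℕ) (q : M.Quot) :
    M.opPowQ J₀ w μ ((M.quotDer J₀ x)^[k] q) = (M.quotDer J₀ x)^[k] (M.opPowQ J₀ w μ q) := by
  induction k generalizing q with
  | zero => rfl
  | succ k ih => rw [Function.iterate_succ_apply', Function.iterate_succ_apply', M.opPowQ_quotDer ha₀, ih]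

/-- Iterates of commuting derivations commute. [folklore] -/
theorem iterate_iterate_comm (x y : V) (m j : ℕ) (q : M.Quot) :
    (M.quotDer J₀ x)^[m] ((M.quotDer J₀ y)^[j] q) = (M.quotDer J₀ y)^[j] ((M.quotDer J₀ x)^[m] q) := by
  induction j generalizing q with
  | zero => rfl
  | succ j ih => rw [Function.iterate_succ_apply', Function.iterate_succ_apply', M.iterate_quotDer_comm ha₀, ih]

/-- **The binomial expansion**: `d_{t•x+v}^n q = ∑_k binom(n,k) t^k · d_x^k(d_v^{n-k} q)` (the
operators commute). [folklore] -/
theorem iterate_quotDer_add_smul (t : ℂ) (x v : V) (n : ℕ) (q : M.Quot) :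
    (M.quotDer J₀ (t • x + v))^[n] q =
      ∑ k ∈ Finset.range (n + 1), ((n.choose k : ℂ) * t ^ k) •
        (M.quotDer J₀ x)^[k] ((M.quotDer J₀ v)^[n - k] q) := by
  set Dx : Module.End ℂ M.Quot := (M.quotDer J₀ x : M.Quot →ₗ[ℂ] M.Quot) with hDx
  set Dv : Module.End ℂ M.Quot := (M.quotDer J₀ v : M.Quot →ₗ[ℂ] M.Quot) with hDv
  have hcomm : Commute (t • Dx) Dv := by
    rw [commute_iff_eq]
    apply LinearMap.ext
    intro p
    change t • M.quotDer J₀ x (M.quotDer J₀ v p) = M.quotDer J₀ v (t • M.quotDer J₀ x p)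
    rw [M.quotDer_comm ha₀, Derivation.map_smul]
  have hsum : ((M.quotDer J₀ (t • x + v) : M.Quot →ₗ[ℂ] M.Quot) : Module.End ℂ M.Quot) = t • Dx + Dv := by
    apply LinearMap.ext
    intro p
    change M.quotDer J₀ (t • x + v) p = t • M.quotDer J₀ x p + M.quotDer J₀ v p
    rw [M.quotDer_add ha₀, M.quotDer_smul ha₀]
  rw [← M.pow_apply_eq_iterate, hsum, hcomm.add_pow, LinearMap.sum_apply]
  refine Finset.sum_congr rfl fun k _ => ?_
  rw [Module.End.mul_apply, Module.End.mul_apply, Module.End.natCast_apply, smul_pow,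
    LinearMap.smul_apply, map_nsmul, map_nsmul, hDx, hDv, M.pow_apply_eq_iterate,
    M.pow_apply_eq_iterate, ← Nat.cast_smul_eq_nsmul ℂ, smul_smul, mul_comm]

/-- **Polarisation.** If all pure powers `d_x^n q`, `x ∈ W`, are killed by `evalQ a` (for a fixed
`n` and all `x ∈ W`) then so are all `D^μ q` with `|μ| = n` and directions in `W`.
[cite: NesterenkoPhilippon2001, Ch. 11 Prop. 3.8 Step 3 (∂^λ)] -/
theorem evalQ_opPowQ_eq_zero_of_pure (a : V) (W : Submodule ℂ V) :
    ∀ (s : ℕ) (w : Fin s → V), (∀ i, w i ∈ W) → ∀ (n : ℕ) (q : M.Quot),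
      (∀ x ∈ W, M.evalQ a ((M.quotDer J₀ x)^[n] q) = 0) →
      ∀ μ : Fin s → ℕ, ∑ i, μ i = n → M.evalQ a (M.opPowQ J₀ w μ q) = 0 := by
  intro s
  induction s with
  | zero =>
    intro w _ n q hq μ hμ
    simp only [Finset.univ_eq_empty, Finset.sum_empty] at hμ
    subst hμ
    simpa using hq 0 W.zero_mem
  | succ s ih =>
    intro w hw n q hq μ hμ
    rw [opPowQ_succ]
    -- expand `d_{t • w 0 + v}^n` for `v = ∑_{i ≥ 1} c_i w_i`-type directions: use the hypothesis at
    -- `x = t • w 0 + v` for all `v` in `W' = span (tail w)`; here we only need `v ∈ W`.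
    have key : ∀ v ∈ W, ∀ k ≤ n, M.evalQ a ((M.quotDer J₀ v)^[n - k] ((M.quotDer J₀ (w 0))^[k] q)) = 0 := by
      intro v hv
      apply coeff_eq_zero_of_forall_sum_eq_zero
      intro t
      have h := hq (t • w 0 + v) (W.add_mem (W.smul_mem t (hw 0)) hv)
      rw [M.iterate_quotDer_add_smul ha₀, map_sum] at h
      rw [← h]
      refine Finset.sum_congr rfl fun k _ => ?_
      rw [map_smul, smul_eq_mul, M.iterate_iterate_comm ha₀]
    -- apply the induction hypothesis to `q' = d_{w 0}^{μ 0} q` and `n' = n - μ 0`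
    have hμ0 : μ 0 ≤ n := by
      rw [← hμ, Fin.sum_univ_succ]; exact Nat.le_add_right _ _
    have htail : ∑ i, Fin.tail μ i = n - μ 0 := by
      rw [← hμ, Fin.sum_univ_succ]
      simp [Fin.tail]
    have hq' : ∀ x ∈ W, M.evalQ a ((M.quotDer J₀ x)^[n - μ 0] ((M.quotDer J₀ (w 0))^[μ 0] q)) = 0 :=
      fun x hx => key x hx (μ 0) hμ0
    have := ih (Fin.tail w) (fun i => hw i.succ) (n - μ 0) ((M.quotDer J₀ (w 0))^[μ 0] q) hq'
      (Fin.tail μ) htail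
    rwa [M.opPowQ_iterate ha₀] at this

/-- **Polarisation, all orders**: if `evalQ a (d_x^k q) = 0` for all `x ∈ W` and `k ≤ T` then
`evalQ a (D^μ q) = 0` for all directions in `W` and `|μ| ≤ T`. [cite: NesterenkoPhilippon2001, Ch. 11 Prop. 3.8 Step 3] -/
theorem evalQ_opPowQ_eq_zero_of_forall_pure (a : V) (W : Submodule ℂ V) {T : ℕ} {q : M.Quot}
    (hq : ∀ x ∈ W, ∀ k ≤ T, M.evalQ a ((M.quotDer J₀ x)^[k] q) = 0) {s : ℕ} (w : Fin s → V)
    (hw : ∀ i, w i ∈ W) (μ : Fin s → ℕ) (hμ : ∑ i, μ i ≤ T) : M.evalQ a (M.opPowQ J₀ w μ q) = 0 :=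
  M.evalQ_opPowQ_eq_zero_of_pure ha₀ a W s w hw (∑ i, μ i) q (fun x hx => hq x hx _ hμ) μ rfl

end Polar

end AnalyticGroupModel

end Literature.NumberTheory.Transcendental
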